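import Mathlib
import Summits.ValiantsHypothesis.ValiantsHypothesis.Theses.LiouvilleSarnak
import Summits.ValiantsHypothesis.ValiantsHypothesis.Theorems.LiouvilleSarnakCutRankFour

/-!
# Route LiouvilleSarnak — rung `LiouvilleCutRankFour` (stmt-ValiantsHypothesis-21039), line
# `window_certificate`: the registered stub `stub_goodWindow`

The registered skeleton `Cruxes/LiouvilleCutRankFour/Lines/window_certificate.lean`
(planner `val-width-lines-2`, 2026-08-27) cuts the proof of the rung `LiouvilleCutRankFour`
(the `W = 4` instance of the crux `LiouvilleCutRank`, stmt-14775; PROVED in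
`Theorems/LiouvilleSarnakCutRankFour.lean`) into two stubs.  This file proves the first one,
`stub_goodWindow`, with the skeleton-local definitions `windowCode` / `goodCodes` UNFOLDED
(so the statement below is definitionally the registered signature and the skeleton closes its
`sorry` by the one-line term `stub_goodWindow n hn π` of this namespace):

* for `n ≥ 3` and every balanced cut `π : Fin n ⊕ Fin n ≃ Fin (2n)` there are five consecutive
  bit positions `s, …, s+4 < 2n` whose row/column word (bit `k` set iff position `s + k` is a row
  bit) is one of the eighteen GOOD codes `{3, 5, 6, 7, 10, 11, 12, 13, 14, 17, 18, 19, 20, 21,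
  24, 25, 26, 28}` — the words with two or three row letters other than `RCCRC = 9` and
  `CRRCR = 22`.

This is a slightly stronger combinatorial statement than the counting lemma
`exists_good_window` of the closer (which allows all twenty words with two or three row
letters).  Proof (sliding window, elementary):

* §1 a `decide`d step fact on six consecutive letters: if neither of the two windows inside them
  is good, the LATER window has `≤ 1` or `≥ 4` row letters (the words `9`, `22` can only be
  preceded by good words);
* §2 hence, if no window is good, every window starting at a position `≥ 1` has `≤ 1` or `≥ 4`
  row letters, and since consecutive window counts differ by `≤ 1` (closer's `count_window_succ`)
  they are ALL `≤ 1` or ALL `≥ 4`;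
* §3 a sharp block count (`≤ 1` per window on `[0, N)` gives `≤ (N + 4)/5` letters) bounds the row
  letters (resp. column letters) among the positions `1, …, 2n-1` by `(2n + 3)/5`, so one letter
  occurs `≤ 1 + (2n+3)/5 < n` times — contradicting balance (`n` of each, closer's
  `le_count_isLeft` / `le_count_not_isLeft`).

Honest framing: bookkeeping for a registered line of an already PROVED finite rung (`W = 4`);
the crux `LiouvilleCutRank` (every `W`), `DigitalBilinearLiouville` and `AlgebraicSarnak` stay
open, and nothing here bears on VP versus VNP.  No definitions.
-/

-- the problem directory `ValiantsHypothesis/ValiantsHypothesis` repeats the summit name (tree layout)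
set_option linter.dupNamespace false

namespace Summit.ValiantsHypothesis.ValiantsHypothesis.Theorems.LiouvilleSarnakCutRankFour.WindowCertificate

/-! ### §1 The step fact on six consecutive letters -/

/-- **Step fact** (`decide` over the `64` six-letter words `m`, bit `k` = letter `k` is a row
letter): if neither the window `m₀…m₄` nor the window `m₁…m₅` is a good code, then the later
window has at most one or at least four row letters. [folklore] -/
theorem sixLetter_step : ∀ m < 64,
    Nat.ofBits (fun k : Fin 5 => Nat.testBit m k) ∉
      ({3, 5, 6, 7, 10, 11, 12, 13, 14, 17, 18, 19, 20, 21, 24, 25, 26, 28} : Finset ℕ) →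
    Nat.ofBits (fun k : Fin 5 => Nat.testBit m (k + 1)) ∉
      ({3, 5, 6, 7, 10, 11, 12, 13, 14, 17, 18, 19, 20, 21, 24, 25, 26, 28} : Finset ℕ) →
    Nat.count (fun k => Nat.testBit m (k + 1) = true) 5 ≤ 1 ∨
      4 ≤ Nat.count (fun k => Nat.testBit m (k + 1) = true) 5 := by
  decide

/-- The step fact along a letter sequence `w : ℕ → Bool` (`true` = row letter): if the windows
at `s` and at `s + 1` are both not good, the window at `s + 1` has `≤ 1` or `≥ 4` row letters.
[folklore] -/
theorem window_succ_dichotomy (w : ℕ → Bool) (s : ℕ)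
    (h0 : Nat.ofBits (fun k : Fin 5 => w (s + k)) ∉
      ({3, 5, 6, 7, 10, 11, 12, 13, 14, 17, 18, 19, 20, 21, 24, 25, 26, 28} : Finset ℕ))
    (h1 : Nat.ofBits (fun k : Fin 5 => w (s + 1 + k)) ∉
      ({3, 5, 6, 7, 10, 11, 12, 13, 14, 17, 18, 19, 20, 21, 24, 25, 26, 28} : Finset ℕ)) :
    Nat.count (fun k => w (s + 1 + k) = true) 5 ≤ 1 ∨
      4 ≤ Nat.count (fun k => w (s + 1 + k) = true) 5 := by
  set m : ℕ := Nat.ofBits (fun k : Fin 6 => w (s + k)) with hm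
  have hm64 : m < 64 := Nat.ofBits_lt_two_pow _
  have hbit : ∀ k < 6, Nat.testBit m k = w (s + k) := fun k hk => by
    rw [hm, Nat.testBit_ofBits_lt _ _ hk]
  have e0 : Nat.ofBits (fun k : Fin 5 => Nat.testBit m k) = Nat.ofBits (fun k : Fin 5 => w (s + k)) := by
    congr 1
    funext k
    exact hbit k (by omega)
  have e1 : Nat.ofBits (fun k : Fin 5 => Nat.testBit m (k + 1)) =
      Nat.ofBits (fun k : Fin 5 => w (s + 1 + k)) := by
    congr 1
    funext k
    rw [hbit (k + 1) (by omega), show s + ((k : ℕ) + 1) = s + 1 + k by omega]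
  have ec : Nat.count (fun k => Nat.testBit m (k + 1) = true) 5 =
      Nat.count (fun k => w (s + 1 + k) = true) 5 := by
    apply le_antisymm <;> refine Nat.count_mono_left (fun k hk hpk => ?_)
    · rw [hbit (k + 1) (by omega), show s + (k + 1) = s + 1 + k by omega] at hpk
      exact hpk
    · rw [hbit (k + 1) (by omega), show s + (k + 1) = s + 1 + k by omega]
      exact hpk
  have key := sixLetter_step m hm64 (by rw [e0]; exact h0) (by rw [e1]; exact h1)
  rwa [ec] at key

/-! ### §3 A sharp block count -/

/-- **Sharp block count.** If every length-5 window of `[0, N)` (`N ≥ 5`) contains at most one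
`k` with `p k`, then `#{k < N : p k} ≤ (N + 4)/5`. [folklore] -/
theorem count_le_of_sparse_windows_sharp (p : ℕ → Prop) [DecidablePred p] (N : ℕ) (hN : 5 ≤ N)
    (h : ∀ s, s + 5 ≤ N → Nat.count (fun k => p (s + k)) 5 ≤ 1) :
    Nat.count p N ≤ (N + 4) / 5 := by
  induction N using Nat.strong_induction_on with
  | _ N ih =>
    obtain ⟨t, rfl⟩ : ∃ t, N = t + 5 := ⟨N - 5, by omega⟩
    rw [Nat.count_add]
    have hlast := h t le_rfl
    by_cases ht : 5 ≤ t
    · have := ih t (by omega) ht (fun s hs => h s (by omega))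
      omega
    · rcases Nat.eq_zero_or_pos t with rfl | htpos
      · have h00 : Nat.count p 0 = 0 := Nat.count_zero p
        omega
      · have h0 : Nat.count (fun k => p k) 5 ≤ 1 := by simpa using h 0 (by omega)
        have hmono : Nat.count p t ≤ Nat.count p 5 := Nat.count_monotone p (by omega)
        have h0' : Nat.count p 5 ≤ 1 := h0
        omega

/-! ### §2 The sliding-window argument -/

/-- **Good window along a balanced letter sequence.** If `n ≥ 3` and the letter sequence
`w : ℕ → Bool` has at least `n` row letters (`true`) and at least `n` column letters (`false`)
among the positions `< 2n`, then some window `s, …, s+4 < 2n` carries a good code. [folklore] -/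
theorem exists_good_code (w : ℕ → Bool) (n : ℕ) (hn : 3 ≤ n)
    (hR : n ≤ Nat.count (fun j => w j = true) (2 * n))
    (hC : n ≤ Nat.count (fun j => ¬ w j = true) (2 * n)) :
    ∃ s, s + 5 ≤ 2 * n ∧ Nat.ofBits (fun k : Fin 5 => w (s + k)) ∈
      ({3, 5, 6, 7, 10, 11, 12, 13, 14, 17, 18, 19, 20, 21, 24, 25, 26, 28} : Finset ℕ) := by
  by_contra hno
  push Not at hno
  -- every window starting at a position `≥ 1` has `≤ 1` or `≥ 4` row letters
  have hdich : ∀ s, s + 6 ≤ 2 * n →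
      Nat.count (fun k => w (s + 1 + k) = true) 5 ≤ 1 ∨
        4 ≤ Nat.count (fun k => w (s + 1 + k) = true) 5 :=
    fun s hs => window_succ_dichotomy w s (hno s (by omega)) (hno (s + 1) (by omega))
  -- consecutive window counts differ by at most one
  have hsucc : ∀ s, Nat.count (fun k => w (s + 1 + 1 + k) = true) 5 ≤
        Nat.count (fun k => w (s + 1 + k) = true) 5 + 1 ∧
      Nat.count (fun k => w (s + 1 + k) = true) 5 ≤
        Nat.count (fun k => w (s + 1 + 1 + k) = true) 5 + 1 :=
    fun s => count_window_succ (fun j => w j = true) (s + 1)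
  -- so the two regimes do not mix on the windows starting at `1, 2, …`
  have hregime : (∀ s, s + 6 ≤ 2 * n → Nat.count (fun k => w (s + 1 + k) = true) 5 ≤ 1) ∨
      (∀ s, s + 6 ≤ 2 * n → 4 ≤ Nat.count (fun k => w (s + 1 + k) = true) 5) := by
    rcases hdich 0 (by omega) with h0 | h0
    · left
      intro s
      induction s with
      | zero => exact fun _ => h0
      | succ s ih =>
        intro hs
        have h1 := ih (by omega)
        have h2 := (hsucc s).1
        rcases hdich (s + 1) hs with h3 | h3 <;> omega
    · right
      intro s
      induction s with
      | zero => exact fun _ => h0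
      | succ s ih =>
        intro hs
        have h1 := ih (by omega)
        have h2 := (hsucc s).2
        rcases hdich (s + 1) hs with h3 | h3 <;> omega
  -- split off position `0`: `#{j < 2n} = #{j < 2n - 1 shifted by one} + [position 0]`
  have hsplitR : Nat.count (fun j => w j = true) (2 * n) =
      Nat.count (fun j => w (j + 1) = true) (2 * n - 1) + if w 0 = true then 1 else 0 := by
    have := Nat.count_succ' (fun j => w j = true) (2 * n - 1)
    rw [show 2 * n - 1 + 1 = 2 * n by omega] at this
    exact this
  have hsplitC : Nat.count (fun j => ¬ w j = true) (2 * n) =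
      Nat.count (fun j => ¬ w (j + 1) = true) (2 * n - 1) + if ¬ w 0 = true then 1 else 0 := by
    have := Nat.count_succ' (fun j => ¬ w j = true) (2 * n - 1)
    rw [show 2 * n - 1 + 1 = 2 * n by omega] at this
    exact this
  have hle1R : (if w 0 = true then 1 else 0) ≤ 1 := by split_ifs <;> omega
  have hle1C : (if ¬ w 0 = true then 1 else 0) ≤ 1 := by split_ifs <;> omega
  rcases hregime with hlo | hhi
  · -- few row letters
    have hwin : ∀ s, s + 5 ≤ 2 * n - 1 →
        Nat.count (fun k => w (s + k + 1) = true) 5 ≤ 1 := by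
      intro s hs
      have h1 := hlo s (by omega)
      have e : Nat.count (fun k => w (s + k + 1) = true) 5 =
          Nat.count (fun k => w (s + 1 + k) = true) 5 := by
        apply le_antisymm <;> refine Nat.count_mono_left (fun k _ hpk => ?_)
        · rw [Nat.add_right_comm s k 1] at hpk
          exact hpk
        · rw [Nat.add_right_comm s k 1]
          exact hpk
      rw [e]
      exact h1
    have hq := count_le_of_sparse_windows_sharp (fun j => w (j + 1) = true) (2 * n - 1)
      (by omega) hwin
    omega
  · -- few column letters
    have hwin : ∀ s, s + 5 ≤ 2 * n - 1 →
        Nat.count (fun k => ¬ w (s + k + 1) = true) 5 ≤ 1 := by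
      intro s hs
      have h1 := hhi s (by omega)
      have h2 := count_add_count_not (fun k => w (s + 1 + k) = true) 5
      have e : Nat.count (fun k => ¬ w (s + k + 1) = true) 5 =
          Nat.count (fun k => ¬ w (s + 1 + k) = true) 5 := by
        apply le_antisymm <;> refine Nat.count_mono_left (fun k _ hpk => ?_)
        · rw [Nat.add_right_comm s k 1] at hpk
          exact hpk
        · rw [Nat.add_right_comm s k 1]
          exact hpk
      rw [e]
      omega
    have hq := count_le_of_sparse_windows_sharp (fun j => ¬ w (j + 1) = true) (2 * n - 1)
      (by omega) hwin
    omega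

/-! ### The registered stub -/

/-- **Registered stub `stub_goodWindow` of the line `window_certificate`** (with `windowCode` and
`goodCodes` unfolded): for `n ≥ 3`, every balanced cut `π` of the `2n` bit positions has five
consecutive positions `s, …, s+4` whose row/column word is one of the eighteen good codes.
[folklore] -/
theorem stub_goodWindow :
    ∀ n : ℕ, 3 ≤ n → ∀ π : Fin n ⊕ Fin n ≃ Fin (2 * n),
      ∃ (s : ℕ) (hs : s + 5 ≤ 2 * n),
        (Nat.ofBits fun k : Fin 5 => (π.symm ⟨s + k, by omega⟩).isLeft) ∈
          ({3, 5, 6, 7, 10, 11, 12, 13, 14, 17, 18, 19, 20, 21, 24, 25, 26, 28} : Finset ℕ) := by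
  intro n hn π
  obtain ⟨s, hs, hmem⟩ := exists_good_code
    (fun j => if h : j < 2 * n then (π.symm ⟨j, h⟩).isLeft else false) n hn
    (le_count_isLeft n π) (le_count_not_isLeft n π)
  refine ⟨s, hs, ?_⟩
  have e : (fun k : Fin 5 => (π.symm ⟨s + k, by omega⟩).isLeft) =
      fun k : Fin 5 => (fun j => if h : j < 2 * n then (π.symm ⟨j, h⟩).isLeft else false) (s + k) := by
    funext k
    simp only [dif_pos (show s + (k : ℕ) < 2 * n by omega)]
  rw [e]
  exact hmem

end Summit.ValiantsHypothesis.ValiantsHypothesis.Theorems.LiouvilleSarnakCutRankFour.WindowCertificate
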